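import Literature.MathematicalPhysics.QuantumFieldTheory.BalabanImbrieJaffe1984to88.BIJ88PertTerms5141

/-!
# `BalabanImbrieJaffe1984to88.BIJ88RestrictionsL1Decay308` — T. Bałaban, J. Imbrie, A. Jaffe, *Effective action and cluster properties of the
abelian Higgs model*, Commun. Math. Phys. **114** (1988) 257–315 [BalabanImbrieJaffe1988], Sect. 5.14 pp. 308–309 [PDF 52–53]: p. 308 *"Thus the
restrictions and the interactions disappear at t = 0, at which point we have a purely Gaussian expectation. Thus we define perturbative terms for
the action, 𝒫̃_{k+1}(Λ₁₂^{(k)}) = Σ_{α=1}^{n̄} −(1/α!)(dᵅ/dtᵅ) log z_t(Λ₁₂^{(k)})|_{t=0} (5.14.1)"*; p. 309 *"the n-th derivative in t of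
χ(cp(e_k), A^{(k)}) [sic; = χ(cp(te_k), A^{(k)})] is bounded by t^{−n} times a function bounded by a constant and supported in
c₁p(te_k) ≤ |A^{(k)}| ≤ c₂p(te_k). After integration over A^{(k)}, we obtain factors ct^{−n}e^{−cp(te_k)²}"* — **THE p. 309 SENTENCE AS AN
L¹ HYPOTHESIS**: everything the p. 308 chain of this seat (gens 7–8: `BIJ88GaussianMoments308`, `BIJ88PertTerms5141`) derives from CENTRED
Gaussian marginals is derived here from the single hypothesis that the restriction derivatives vanish in `L¹(P)` as `t → 0⁺`,
`hL1 : ∀ i ≥ 1, ∫ |(∂/∂t)ⁱ χ′_{Λ,t}| dP → 0`, `χ′_{Λ,t} = Π_{b∈Λ} χ(c_b p(te_k), Φ_b)`,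
which is exactly what the located p. 309 sentence delivers (`ct^{−n}e^{−cp(te_k)²} → 0`), for centred AND non-centred Gaussian fields alike
(the §5.13 law of (5.14.3) has mean `Δ⁻¹ℱ ≠ 0`; the Gaussian instances are in the sibling file `BIJ88GaussShellNoncentred309`).

statement-level skeleton of published theorems with citation tags; proofs where landed; nothing here is a claim about the Yang–Mills mass gap

PDF held: `paper:balaban1988-cmp114-bij-abelian-higgs-effective-action` (journal page = PDF page + 256); pp. 308–309 = PDF 52–53 (`p0052.txt`
L20–27, `p0053.txt` L1–12 re-read this generation).

WHAT IS REPRODUCED (unit `lit-balaban-p36`, generation 12 of the Phase-2 proof seat p36, file 1 of 3; SKELETON rows **C2.Eq5.14.1-5.14.2**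
((5.14.1)–(5.14.2), member) and **C2.Eq5.14.3-5.14.4** (the p. 309 sentence, member) of `HOME/lit-balaban-r16/ROWS-C2-part2.md`, owner r16, heads
untouched; HOME `run/shared/lean/pub/lit-balaban/`).  Theorems only (0 definitions, 0 `Prop` facts):
* §1 LIMITS `t → 0⁺` UNDER `hL1` for the restricted interacting family `z(t) = ∫ χ′_{Λ,t} e^{−tW} dμ` (measurable fields, `c_b ≠ 0` resp.
  `c_b > 0`, measurable `|W| ≤ K`, `e_k > 0`, `p > 0`): `tendsto_integral_mixedTerm_zero_of_L1` (the `i ≥ 1` Leibniz terms vanish),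
  **`tendsto_iteratedDeriv_integral_restrictedInteraction_zero_of_L1`** (`z^{(n)}(t) → ∫(−W)ⁿ dμ`),
  **`tendsto_iteratedDeriv_log_restrictedInteraction_cgf_of_L1`** (`(log z)^{(α)}(t) → (dᵅ/dtᵅ)|₀ cgf_{−W}`: the perturbative terms are the
  cumulants of `−Ṽ` in the `t = 0` measure), `tendsto_pertPart_restrictedInteraction_of_L1`.
* §2 A GENERIC ONE-SIDED `C^∞` EXTENSION LEMMA (pure calculus, no measure): a real function `Cⁿ` at every point of `(0,1]` for every `n`, all of
  whose iterated derivatives have limits `L β` at `0⁺` with `f 0 = L 0`, is `Cⁿ` on `[0,1]` for every `n` with `iteratedDerivWithin β f [0,1] 0 = L β`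
  (`iteratedDerivWithin_Icc_zero_eq_of_tendsto`, `hasDerivWithinAt_iteratedDerivWithin_Icc_zero_of_tendsto`,
  `differentiableOn_iteratedDerivWithin_Icc_of_tendsto`, **`contDiffOn_Icc_of_tendsto_iteratedDeriv`**) — gen 8's induction
  (`BIJ88PertTerms5141` §2, Mathlib `hasDerivWithinAt_Ici_of_tendsto_deriv`) with the family abstracted away.
* §3 THE p. 308 FAMILY ON `[0,1]` UNDER `hL1` (probability measure, `p > 0`, `c_b ≥ c₀ > 0`, `0 < e_k < e^{−1}`, `z_t ≠ 0` on `(0,1]`):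
  **`iteratedDerivWithin_log_restrictedInteraction_zero_of_L1`**, **`contDiffOn_Icc_log_restrictedInteraction_of_L1`** (`log z ∈ Cⁿ[0,1]`),
  **`pertP_restrictedInteraction_of_L1`** (the row owner's typed `𝒫̃_{k+1}` = `pertPart n̄ (cgf_{−W})`), `taylor_logz_restrictedInteraction_of_L1`.
HONEST SCOPE: no Gaussian hypothesis appears in this file — the located p. 309 sentence is the INPUT `hL1`; gen 7–8's centred theorems are the
instance `hL1 := BIJ88RestrictionsAllOrders308`-decay, and the non-centred Gaussian instance is `BIJ88GaussShellNoncentred309` (this generation).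
0 `sorry`, 0 definitions, 0 new `Prop` facts (D-0026); imports `BIJ88PertTerms5141` only; modifies nothing.  NOT summit progress; NOT continuum;
NOT Clay.  Cell `lit-balaban` Phase 2, seat p36 gen 12 (owner r16, referee ref-5).
-/

namespace Literature.MathematicalPhysics.QuantumFieldTheory.BalabanImbrieJaffe1984to88.BIJ88RestrictionsL1Decay308

open MeasureTheory ProbabilityTheory Filter Set
open scoped Nat Topology
open BIJ88Sect2Statements (pLog)
open BIJ88Sect5Statements (CutoffProfile cutoff)
open BIJ88Sect5StatementsPart4 (pertP)
open BIJ88Perturbative341 (pertPart)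
open BIJ88RestrictedInteractionAllOrders308 (iteratedDeriv_restrictedInteraction iteratedDeriv_integral_restrictedInteraction)

/-! ## §1 Limits `t → 0⁺` under the L¹ hypothesis -/

section Limits

variable (χ : CutoffProfile) {ι Ω : Type*} [MeasurableSpace Ω]

/-- **The `i ≥ 1` Leibniz terms vanish under the L¹ hypothesis**: for any finite measure, measurable fields, `c_b ≠ 0`, `|W| ≤ K`, `e_k > 0`, if
`∫ |(∂/∂t)ⁱχ′_{Λ,t}| dμ → 0` as `t → 0⁺` then `∫ (∂ⁱ_tχ′_{Λ,t})·((−W)^m e^{−tW}) dμ → 0` (p. 309: *"After integration over A^{(k)}, we obtain factors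
ct^{−n}e^{−cp(te_k)²}"* — those factors as the hypothesis). [cite: BalabanImbrieJaffe1988, p.309 (Sect. 5.14)] -/
theorem tendsto_integral_mixedTerm_zero_of_L1 (p : ℝ) (μ : Measure Ω) [IsFiniteMeasure μ] (B : Finset ι) {Φ : ι → Ω → ℝ}
    (hΦ : ∀ b ∈ B, Measurable (Φ b)) {c : ι → ℝ} (hc : ∀ b ∈ B, c b ≠ 0) (W : Ω → ℝ) {K : ℝ} (hK : ∀ ω, |W ω| ≤ K) {ek : ℝ}
    (hek : 0 < ek) {i : ℕ}
    (hL1 : Tendsto (fun t => ∫ ω, |iteratedDeriv i (fun s => ∏ b ∈ B, cutoff χ (c b * pLog p (s * ek)) (Φ b ω)) t| ∂μ)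
      (𝓝[>] (0 : ℝ)) (𝓝 0)) (m : ℕ) :
    Tendsto (fun t => ∫ ω, iteratedDeriv i (fun s => ∏ b ∈ B, cutoff χ (c b * pLog p (s * ek)) (Φ b ω)) t *
      ((-W ω) ^ m * Real.exp (-(t * W ω))) ∂μ) (𝓝[>] (0 : ℝ)) (𝓝 0) := by
  obtain ⟨C', -, hC'⟩ := BIJ88GaussIntegration309Product.abs_iteratedDeriv_prod_cutoff_t_le (ι := ι) χ p i
  set E : ℝ := |K| ^ m * Real.exp (max K 0) with hEdef
  have hE0 : 0 ≤ E := by positivity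
  refine squeeze_zero_norm' (a := fun t => E *
      ∫ ω, |iteratedDeriv i (fun s => ∏ b ∈ B, cutoff χ (c b * pLog p (s * ek)) (Φ b ω)) t| ∂μ) ?_ ?_
  · filter_upwards [BIJ88RestrictedInteraction308.eventually_branch ek] with t ht
    have ht0 := ht.1
    have hlt1 : t * ek < 1 := ht.2.2.trans (by rw [← Real.exp_zero]; exact Real.exp_lt_exp.mpr (by norm_num))
    have hwt : ∀ ω, |(-W ω) ^ m * Real.exp (-(t * W ω))| ≤ E := fun ω => by
      rw [abs_mul, Real.abs_exp, hEdef]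
      have hWm : |(-W ω) ^ m| ≤ |K| ^ m := by
        rw [abs_pow, abs_neg]; exact pow_le_pow_left₀ (abs_nonneg _) ((hK ω).trans (le_abs_self K)) _
      exact mul_le_mul hWm (BIJ88RestrictedInteraction308.exp_neg_mul_le_exp_max (hK ω) ht0.le ht.2.1) (Real.exp_pos _).le
        (pow_nonneg (abs_nonneg _) _)
    have hmeasD := BIJ88RestrictionsAllOrders308.measurable_iteratedDeriv_prod_cutoff_t χ p B hΦ c hek i ht0 hlt1
    have hpt : ∀ ω, |iteratedDeriv i (fun s => ∏ b ∈ B, cutoff χ (c b * pLog p (s * ek)) (Φ b ω)) t *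
        ((-W ω) ^ m * Real.exp (-(t * W ω)))| ≤
        E * |iteratedDeriv i (fun s => ∏ b ∈ B, cutoff χ (c b * pLog p (s * ek)) (Φ b ω)) t| := fun ω => by
      rw [abs_mul, mul_comm]
      exact mul_le_mul_of_nonneg_right (hwt ω) (abs_nonneg _)
    have hDint : Integrable (fun ω => |iteratedDeriv i (fun s => ∏ b ∈ B, cutoff χ (c b * pLog p (s * ek)) (Φ b ω)) t|) μ := by
      refine (integrable_const (((B.card : ℝ) * C') ^ i * t ^ (-(i : ℤ)))).mono' hmeasD.abs.aestronglyMeasurable ?_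
      refine Filter.Eventually.of_forall fun ω => ?_
      rw [Real.norm_eq_abs, abs_abs]
      exact hC' B (fun b => Φ b ω) c hc hek ht0 ht.2.2.le i le_rfl
    rw [Real.norm_eq_abs, ← integral_const_mul]
    exact abs_integral_le_integral_abs.trans (integral_mono_of_nonneg (Filter.Eventually.of_forall fun ω => abs_nonneg _)
      (hDint.const_mul _) (Filter.Eventually.of_forall fun ω => hpt ω))
  · simpa only [mul_zero] using hL1.const_mul E

/-- **Every Taylor coefficient of `z_t` at `t = 0⁺` is a moment of `−Ṽ` in the `t = 0` measure, UNDER THE L¹ HYPOTHESIS** (p. 308: *"at which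
point we have a purely Gaussian expectation"*): for a finite measure, measurable fields, positive thresholds, `p > 0`, `e_k > 0`, measurable
`|W| ≤ K` and `hL1 : ∀ i ≥ 1, ∫ |(∂/∂t)ⁱχ′_{Λ,t}| dμ → 0`: `z^{(n)}(t) → ∫ (−W)ⁿ dμ` as `t → 0⁺`, every `n` — gen 7's
`BIJ88GaussianMoments308.tendsto_iteratedDeriv_integral_restrictedInteraction_zero` with the centred-Gaussian input replaced by `hL1`.
[cite: BalabanImbrieJaffe1988, (5.14.2) p.308] -/
theorem tendsto_iteratedDeriv_integral_restrictedInteraction_zero_of_L1 {p : ℝ} (hp : 0 < p) (μ : Measure Ω) [IsFiniteMeasure μ]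
    (B : Finset ι) {Φ : ι → Ω → ℝ} (hΦ : ∀ b ∈ B, Measurable (Φ b)) {c : ι → ℝ} (hc : ∀ b ∈ B, 0 < c b) {W : Ω → ℝ}
    (hW : Measurable W) {K : ℝ} (hK : ∀ ω, |W ω| ≤ K) {ek : ℝ} (hek : 0 < ek)
    (hL1 : ∀ i, 1 ≤ i → Tendsto (fun t => ∫ ω, |iteratedDeriv i (fun s => ∏ b ∈ B, cutoff χ (c b * pLog p (s * ek)) (Φ b ω)) t| ∂μ)
      (𝓝[>] (0 : ℝ)) (𝓝 0)) (n : ℕ) :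
    Tendsto (fun t => iteratedDeriv n
        (fun t => ∫ ω, (∏ b ∈ B, cutoff χ (c b * pLog p (t * ek)) (Φ b ω)) * Real.exp (-(t * W ω)) ∂μ) t)
      (𝓝[>] (0 : ℝ)) (𝓝 (∫ ω, (-W ω) ^ n ∂μ)) := by
  have hcne : ∀ b ∈ B, c b ≠ 0 := fun b hb => (hc b hb).ne'
  -- the limit of the Leibniz sum: only i = 0 survives
  have hsum : Tendsto (fun t => ∑ i ∈ Finset.range (n + 1), (n.choose i : ℝ) *
      ∫ ω, iteratedDeriv i (fun s => ∏ b ∈ B, cutoff χ (c b * pLog p (s * ek)) (Φ b ω)) t *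
        ((-W ω) ^ (n - i) * Real.exp (-(t * W ω))) ∂μ) (𝓝[>] (0 : ℝ))
      (𝓝 (∑ i ∈ Finset.range (n + 1), if i = 0 then ∫ ω, (-W ω) ^ n ∂μ else 0)) := by
    refine tendsto_finsetSum _ fun i hi => ?_
    rcases Nat.eq_zero_or_pos i with h | h
    · subst h
      simp only [Nat.choose_zero_right, Nat.cast_one, one_mul, iteratedDeriv_zero, Nat.sub_zero, if_true]
      exact BIJ88GaussianMoments308.tendsto_integral_momentTerm_zero χ hp μ B hΦ hc hW hK hek n
    · rw [if_neg h.ne']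
      have h := (tendsto_integral_mixedTerm_zero_of_L1 χ p μ B hΦ hcne W hK hek (hL1 i h) (n - i)).const_mul (n.choose i : ℝ)
      rw [mul_zero] at h
      exact h
  rw [Finset.sum_ite_eq' (Finset.range (n + 1)) 0, if_pos (Finset.mem_range.mpr (Nat.succ_pos n))] at hsum
  refine hsum.congr' ?_
  filter_upwards [BIJ88RestrictedInteraction308.eventually_branch ek] with t ht
  have hlt1 : t * ek < 1 := ht.2.2.trans (by rw [← Real.exp_zero]; exact Real.exp_lt_exp.mpr (by norm_num))
  rw [iteratedDeriv_integral_restrictedInteraction χ p μ B hΦ hcne hW hK hek n ht.1 ht.2.2]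
  -- integrate the Leibniz sum term by term
  have hint : ∀ i ∈ Finset.range (n + 1), Integrable (fun ω => (n.choose i : ℝ) *
      iteratedDeriv i (fun s => ∏ b ∈ B, cutoff χ (c b * pLog p (s * ek)) (Φ b ω)) t *
        ((-W ω) ^ (n - i) * Real.exp (-(t * W ω)))) μ := by
    intro i hi
    obtain ⟨C', -, hC'⟩ := BIJ88GaussIntegration309Product.abs_iteratedDeriv_prod_cutoff_t_le (ι := ι) χ p i
    have hm := ((BIJ88RestrictionsAllOrders308.measurable_iteratedDeriv_prod_cutoff_t χ p B hΦ c hek i ht.1 hlt1).const_mul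
      (n.choose i : ℝ)).mul ((hW.neg.pow_const (n - i)).mul (Real.measurable_exp.comp (hW.const_mul t).neg))
    refine (integrable_const ((n.choose i : ℝ) * (((B.card : ℝ) * C') ^ i * t ^ (-(i : ℤ))) *
      (K ^ (n - i) * Real.exp (max K 0)))).mono' hm.aestronglyMeasurable (Filter.Eventually.of_forall fun ω => ?_)
    have hD := hC' B (fun b => Φ b ω) c hcne hek ht.1 ht.2.2.le i le_rfl
    have hWm : |(-W ω) ^ (n - i)| ≤ K ^ (n - i) := by
      rw [abs_pow, abs_neg]; exact pow_le_pow_left₀ (abs_nonneg _) (hK ω) _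
    have hE := BIJ88RestrictedInteraction308.exp_neg_mul_le_exp_max (hK ω) ht.1.le ht.2.1
    rw [Real.norm_eq_abs, abs_mul, abs_mul, abs_mul, Nat.abs_cast, Real.abs_exp]
    refine mul_le_mul (mul_le_mul_of_nonneg_left hD (Nat.cast_nonneg _)) (mul_le_mul hWm hE (Real.exp_pos _).le
      (pow_nonneg ((abs_nonneg _).trans (hK ω)) _)) (mul_nonneg (abs_nonneg _) (Real.exp_pos _).le) ?_
    exact mul_nonneg (Nat.cast_nonneg _) ((abs_nonneg _).trans hD)
  have hleib : (∫ ω, iteratedDeriv n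
      (fun s => (∏ b ∈ B, cutoff χ (c b * pLog p (s * ek)) (Φ b ω)) * Real.exp (-(s * W ω))) t ∂μ) =
      ∫ ω, ∑ i ∈ Finset.range (n + 1), (n.choose i : ℝ) *
        iteratedDeriv i (fun s => ∏ b ∈ B, cutoff χ (c b * pLog p (s * ek)) (Φ b ω)) t *
          ((-W ω) ^ (n - i) * Real.exp (-(t * W ω))) ∂μ :=
    integral_congr_ae (Filter.Eventually.of_forall fun ω =>
      iteratedDeriv_restrictedInteraction χ p B (fun b => Φ b ω) c (W ω) hek ht.1 hlt1 n)
  rw [hleib, integral_finsetSum _ hint]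
  refine Finset.sum_congr rfl fun i _ => ?_
  rw [← integral_const_mul]
  refine integral_congr_ae (Filter.Eventually.of_forall fun ω => ?_)
  ring

/-- **(5.14.1) under the L¹ hypothesis: the perturbative terms are the cumulants of `−Ṽ` in the `t = 0` measure.**  For a probability measure,
measurable fields, positive thresholds, `p > 0`, `e_k > 0`, measurable `|W| ≤ K`, `hL1`, and EVERY `α`:
`(dᵅ/dtᵅ) log z_t → (dᵅ/dtᵅ)|_{t=0} cgf_{−W}(t)` as `t → 0⁺` (Faà di Bruno termwise, as in gen 7's
`BIJ88GaussianMoments308.tendsto_iteratedDeriv_log_restrictedInteraction_cgf`). [cite: BalabanImbrieJaffe1988, (5.14.1) p.308] -/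
theorem tendsto_iteratedDeriv_log_restrictedInteraction_cgf_of_L1 {p : ℝ} (hp : 0 < p) (P : Measure Ω) [IsProbabilityMeasure P]
    (B : Finset ι) {Φ : ι → Ω → ℝ} (hΦ : ∀ b ∈ B, Measurable (Φ b)) {c : ι → ℝ} (hc : ∀ b ∈ B, 0 < c b) {W : Ω → ℝ}
    (hW : Measurable W) {K : ℝ} (hK : ∀ ω, |W ω| ≤ K) {ek : ℝ} (hek : 0 < ek)
    (hL1 : ∀ i, 1 ≤ i → Tendsto (fun t => ∫ ω, |iteratedDeriv i (fun s => ∏ b ∈ B, cutoff χ (c b * pLog p (s * ek)) (Φ b ω)) t| ∂P)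
      (𝓝[>] (0 : ℝ)) (𝓝 0)) (α : ℕ) :
    Tendsto (fun t => iteratedDeriv α (fun t => Real.log
        (∫ ω, (∏ b ∈ B, cutoff χ (c b * pLog p (t * ek)) (Φ b ω)) * Real.exp (-(t * W ω)) ∂P)) t)
      (𝓝[>] (0 : ℝ)) (𝓝 (iteratedDeriv α (cgf (fun ω => -W ω) P) 0)) := by
  have hcne : ∀ b ∈ B, c b ≠ 0 := fun b hb => (hc b hb).ne'
  set z : ℝ → ℝ := fun t => ∫ ω, (∏ b ∈ B, cutoff χ (c b * pLog p (t * ek)) (Φ b ω)) * Real.exp (-(t * W ω)) ∂P with hzdef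
  have hz1 : Tendsto z (𝓝[>] (0 : ℝ)) (𝓝 1) := by
    have h := BIJ88RestrictedInteraction308.tendsto_integral_restrictedInteraction_zero χ hp P B hΦ hc hW hK hek
    rwa [probReal_univ] at h
  have hzne : ∀ᶠ t in 𝓝[>] (0 : ℝ), z t ≠ 0 :=
    (hz1.eventually (lt_mem_nhds (by norm_num : (1 : ℝ) / 2 < 1))).mono fun t ht h => by rw [h] at ht; linarith
  -- every Faà di Bruno term converges
  have hterm : ∀ c' : OrderedFinpartition α,
      Tendsto (fun t => iteratedDeriv c'.length Real.log (z t) * ∏ j, iteratedDeriv (c'.partSize j) z t) (𝓝[>] (0 : ℝ))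
        (𝓝 (iteratedDeriv c'.length Real.log 1 * ∏ j, ∫ ω, (-W ω) ^ c'.partSize j ∂P)) := by
    intro c'
    refine ((BIJ88LogZt308.continuousAt_iteratedDeriv_log_one c'.length).tendsto.comp hz1).mul ?_
    exact tendsto_finsetProd _ fun j _ =>
      tendsto_iteratedDeriv_integral_restrictedInteraction_zero_of_L1 χ hp P B hΦ hc hW hK hek hL1 (c'.partSize j)
  have hsum := tendsto_finsetSum (Finset.univ : Finset (OrderedFinpartition α)) fun c' _ => hterm c'
  rw [← BIJ88GaussianMoments308.iteratedDeriv_cgf_zero_eq_sum P hW hK α] at hsum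
  refine hsum.congr' ?_
  filter_upwards [hzne, BIJ88RestrictedInteraction308.eventually_branch ek] with t hzt ht
  have hf := BIJ88GaussianMoments308.contDiffAt_integral_restrictedInteraction χ p P B hΦ hcne hW hK hek α ht.1 ht.2.2
  have hg : ContDiffAt ℝ (α : WithTop ℕ∞) Real.log (z t) := Real.contDiffAt_log.mpr hzt
  exact (iteratedDeriv_comp_eq_sum_orderedFinpartition (g := Real.log) hg hf le_rfl).symm

/-- **(5.14.1) ASSEMBLED under the L¹ hypothesis**: `Σ_{α=1}^{n̄} −(1/α!)(dᵅ/dtᵅ) log z_t` along `t → 0⁺` tends to `pertPart n̄ (cgf_{−W})` (sign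
convention of (3.41), `BIJ88Perturbative341.pertPart`). [cite: BalabanImbrieJaffe1988, (5.14.1) p.308] -/
theorem tendsto_pertPart_restrictedInteraction_of_L1 {p : ℝ} (hp : 0 < p) (P : Measure Ω) [IsProbabilityMeasure P]
    (B : Finset ι) {Φ : ι → Ω → ℝ} (hΦ : ∀ b ∈ B, Measurable (Φ b)) {c : ι → ℝ} (hc : ∀ b ∈ B, 0 < c b) {W : Ω → ℝ}
    (hW : Measurable W) {K : ℝ} (hK : ∀ ω, |W ω| ≤ K) {ek : ℝ} (hek : 0 < ek)
    (hL1 : ∀ i, 1 ≤ i → Tendsto (fun t => ∫ ω, |iteratedDeriv i (fun s => ∏ b ∈ B, cutoff χ (c b * pLog p (s * ek)) (Φ b ω)) t| ∂P)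
      (𝓝[>] (0 : ℝ)) (𝓝 0)) (nbar : ℕ) :
    Tendsto (fun t => ∑ α ∈ Finset.range nbar, -((1 / ((α + 1).factorial : ℝ)) * iteratedDeriv (α + 1) (fun t => Real.log
        (∫ ω, (∏ b ∈ B, cutoff χ (c b * pLog p (t * ek)) (Φ b ω)) * Real.exp (-(t * W ω)) ∂P)) t))
      (𝓝[>] (0 : ℝ)) (𝓝 (pertPart nbar (cgf (fun ω => -W ω) P))) := by
  rw [BIJ88Perturbative341.pertPart_def]
  refine tendsto_finsetSum _ fun α _ => ?_
  exact ((tendsto_iteratedDeriv_log_restrictedInteraction_cgf_of_L1 χ hp P B hΦ hc hW hK hek hL1 (α + 1)).const_mul _).neg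

end Limits

/-! ## §2 A generic one-sided `C^∞` extension lemma at the left end of `[0,1]` -/

section OneSided

variable {f : ℝ → ℝ} {L : ℕ → ℝ}

/-- On `(0,1]` the within-`[0,1]` iterated derivatives of a function smooth there are the ordinary ones.
[cite: BalabanImbrieJaffe1988, (5.14.1) p.308] -/
theorem iteratedDerivWithin_Icc_eq_of_contDiffAt (hf : ∀ n : ℕ, ∀ t ∈ Set.Ioc (0 : ℝ) 1, ContDiffAt ℝ n f t) (β : ℕ) {t : ℝ}
    (ht : t ∈ Set.Ioc (0 : ℝ) 1) : iteratedDerivWithin β f (Set.Icc 0 1) t = iteratedDeriv β f t :=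
  iteratedDerivWithin_eq_iteratedDeriv (uniqueDiffOn_Icc zero_lt_one) (hf β t ht) ⟨ht.1.le, ht.2⟩

/-- **Every one-sided iterated derivative at `t = 0` along `[0,1]` is the limit of the ordinary ones**: for `f` `Cⁿ` at every point of `(0,1]`
(all `n`), `f 0 = L 0`, and `iteratedDeriv β f → L β` at `0⁺` for every `β`: `iteratedDerivWithin α f [0,1] 0 = L α` for every `α` — induction on
`α` via Mathlib `hasDerivWithinAt_Ici_of_tendsto_deriv` (the shape of print's *"(dᵅ/dtᵅ) log z_t|_{t=0}"*).
[cite: BalabanImbrieJaffe1988, (5.14.1) p.308] -/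
theorem iteratedDerivWithin_Icc_zero_eq_of_tendsto (hf : ∀ n : ℕ, ∀ t ∈ Set.Ioc (0 : ℝ) 1, ContDiffAt ℝ n f t) (h0 : f 0 = L 0)
    (hlim : ∀ β : ℕ, Tendsto (iteratedDeriv β f) (𝓝[>] (0 : ℝ)) (𝓝 (L β))) (α : ℕ) :
    iteratedDerivWithin α f (Set.Icc 0 1) 0 = L α := by
  have hB : ∀ β : ℕ, ∀ t ∈ Set.Ioo (0 : ℝ) 1, iteratedDerivWithin β f (Set.Icc 0 1) t = iteratedDeriv β f t :=
    fun β t ht => iteratedDerivWithin_Icc_eq_of_contDiffAt hf β ⟨ht.1, ht.2.le⟩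
  induction α with
  | zero => rw [iteratedDerivWithin_zero]; exact h0
  | succ α ih =>
    rw [iteratedDerivWithin_succ]
    set g : ℝ → ℝ := iteratedDerivWithin α f (Set.Icc 0 1) with hgdef
    have hloc : ∀ t ∈ Set.Ioo (0 : ℝ) 1, g =ᶠ[𝓝 t] iteratedDeriv α f := fun t ht => by
      filter_upwards [isOpen_Ioo.mem_nhds ht] with s hs using hB α s hs
    have h1 : DifferentiableOn ℝ g (Set.Ioo 0 1) := fun t ht =>
      ((hloc t ht).differentiableAt_iff.mpr (BIJ88PertTerms5141.differentiableAt_iteratedDeriv_of_contDiffAt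
        (hf (α + 1) t ⟨ht.1, ht.2.le⟩))).differentiableWithinAt
    have h2 : ContinuousWithinAt g (Set.Ioo 0 1) 0 := by
      rw [ContinuousWithinAt, nhdsWithin_Ioo_eq_nhdsGT zero_lt_one, ih]
      refine (hlim α).congr' ?_
      filter_upwards [Ioo_mem_nhdsGT zero_lt_one] with t ht using (hB α t ht).symm
    have h3 : Tendsto (fun t => deriv g t) (𝓝[>] (0 : ℝ)) (𝓝 (L (α + 1))) := by
      refine (hlim (α + 1)).congr' ?_
      filter_upwards [Ioo_mem_nhdsGT zero_lt_one] with t ht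
      rw [(hloc t ht).deriv_eq, iteratedDeriv_succ]
    have h4 : HasDerivWithinAt g (L (α + 1)) (Set.Icc 0 1) 0 :=
      (hasDerivWithinAt_Ici_of_tendsto_deriv h1 h2 (Ioo_mem_nhdsGT zero_lt_one) h3).mono Set.Icc_subset_Ici_self
    exact h4.derivWithin (uniqueDiffOn_Icc zero_lt_one 0 (Set.left_mem_Icc.mpr zero_le_one))

/-- **Right-differentiability at `t = 0` of every order**: along `[0,1]`, the `α`-th within-derivative of `f` has the right derivative `L (α+1)` at
`t = 0` (hypotheses as above). [cite: BalabanImbrieJaffe1988, (5.14.1) p.308] -/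
theorem hasDerivWithinAt_iteratedDerivWithin_Icc_zero_of_tendsto (hf : ∀ n : ℕ, ∀ t ∈ Set.Ioc (0 : ℝ) 1, ContDiffAt ℝ n f t)
    (h0 : f 0 = L 0) (hlim : ∀ β : ℕ, Tendsto (iteratedDeriv β f) (𝓝[>] (0 : ℝ)) (𝓝 (L β))) (α : ℕ) :
    HasDerivWithinAt (iteratedDerivWithin α f (Set.Icc 0 1)) (L (α + 1)) (Set.Icc 0 1) 0 := by
  have hB : ∀ β : ℕ, ∀ t ∈ Set.Ioo (0 : ℝ) 1, iteratedDerivWithin β f (Set.Icc 0 1) t = iteratedDeriv β f t :=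
    fun β t ht => iteratedDerivWithin_Icc_eq_of_contDiffAt hf β ⟨ht.1, ht.2.le⟩
  set g : ℝ → ℝ := iteratedDerivWithin α f (Set.Icc 0 1) with hgdef
  have hg0 : g 0 = L α := iteratedDerivWithin_Icc_zero_eq_of_tendsto hf h0 hlim α
  have hloc : ∀ t ∈ Set.Ioo (0 : ℝ) 1, g =ᶠ[𝓝 t] iteratedDeriv α f := fun t ht => by
    filter_upwards [isOpen_Ioo.mem_nhds ht] with s hs using hB α s hs
  have h1 : DifferentiableOn ℝ g (Set.Ioo 0 1) := fun t ht =>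
    ((hloc t ht).differentiableAt_iff.mpr (BIJ88PertTerms5141.differentiableAt_iteratedDeriv_of_contDiffAt
      (hf (α + 1) t ⟨ht.1, ht.2.le⟩))).differentiableWithinAt
  have h2 : ContinuousWithinAt g (Set.Ioo 0 1) 0 := by
    rw [ContinuousWithinAt, nhdsWithin_Ioo_eq_nhdsGT zero_lt_one, hg0]
    refine (hlim α).congr' ?_
    filter_upwards [Ioo_mem_nhdsGT zero_lt_one] with t ht using (hB α t ht).symm
  have h3 : Tendsto (fun t => deriv g t) (𝓝[>] (0 : ℝ)) (𝓝 (L (α + 1))) := by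
    refine (hlim (α + 1)).congr' ?_
    filter_upwards [Ioo_mem_nhdsGT zero_lt_one] with t ht
    rw [(hloc t ht).deriv_eq, iteratedDeriv_succ]
  exact (hasDerivWithinAt_Ici_of_tendsto_deriv h1 h2 (Ioo_mem_nhdsGT zero_lt_one) h3).mono Set.Icc_subset_Ici_self

/-- **Every within-`[0,1]` iterated derivative of `f` is differentiable on `[0,1]`** (right derivative at `0`; ordinary derivatives on `(0,1]`).
[cite: BalabanImbrieJaffe1988, (5.14.1) p.308] -/
theorem differentiableOn_iteratedDerivWithin_Icc_of_tendsto (hf : ∀ n : ℕ, ∀ t ∈ Set.Ioc (0 : ℝ) 1, ContDiffAt ℝ n f t)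
    (h0 : f 0 = L 0) (hlim : ∀ β : ℕ, Tendsto (iteratedDeriv β f) (𝓝[>] (0 : ℝ)) (𝓝 (L β))) (α : ℕ) :
    DifferentiableOn ℝ (iteratedDerivWithin α f (Set.Icc 0 1)) (Set.Icc 0 1) := by
  intro t ht
  rcases eq_or_lt_of_le ht.1 with h0t | hpos
  · rw [← h0t]
    exact (hasDerivWithinAt_iteratedDerivWithin_Icc_zero_of_tendsto hf h0 hlim α).differentiableWithinAt
  · have hB : ∀ s ∈ Set.Ioc (0 : ℝ) 1, iteratedDerivWithin α f (Set.Icc 0 1) s = iteratedDeriv α f s :=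
      fun s hs => iteratedDerivWithin_Icc_eq_of_contDiffAt hf α hs
    have hd := BIJ88PertTerms5141.differentiableAt_iteratedDeriv_of_contDiffAt (hf (α + 1) t ⟨hpos, ht.2⟩)
    refine hd.differentiableWithinAt.congr_of_eventuallyEq ?_ (hB t ⟨hpos, ht.2⟩)
    have hmem : Set.Ioc (0 : ℝ) 1 ∈ 𝓝[Set.Icc 0 1] t :=
      mem_nhdsWithin.mpr ⟨Set.Ioi 0, isOpen_Ioi, hpos, fun s hs => ⟨hs.1, hs.2.2⟩⟩
    filter_upwards [hmem] with s hs using hB s hs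

/-- **GENERIC ONE-SIDED `C^∞` EXTENSION**: a real function `Cⁿ` at every point of `(0,1]` for every `n`, with `f 0 = L 0` and
`iteratedDeriv β f → L β` at `0⁺` for every `β`, is `Cⁿ` on the CLOSED interval `[0,1]` for every `n` — the regularity print uses when it writes
*"(dᵅ/dtᵅ) log z_t|_{t=0}"* and Taylor-expands on `[0,1]` (5.14.2); gen 8's `BIJ88PertTerms5141.contDiffOn_Icc_log_restrictedInteraction` with
the family abstracted away. [cite: BalabanImbrieJaffe1988, (5.14.2) p.308] -/
theorem contDiffOn_Icc_of_tendsto_iteratedDeriv (hf : ∀ n : ℕ, ∀ t ∈ Set.Ioc (0 : ℝ) 1, ContDiffAt ℝ n f t) (h0 : f 0 = L 0)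
    (hlim : ∀ β : ℕ, Tendsto (iteratedDeriv β f) (𝓝[>] (0 : ℝ)) (𝓝 (L β))) (n : ℕ) :
    ContDiffOn ℝ n f (Set.Icc 0 1) := by
  have hdiff : ∀ m : ℕ, DifferentiableOn ℝ (iteratedDerivWithin m f (Set.Icc 0 1)) (Set.Icc 0 1) := fun m =>
    differentiableOn_iteratedDerivWithin_Icc_of_tendsto hf h0 hlim m
  have key : ∀ n m : ℕ, ContDiffOn ℝ n (iteratedDerivWithin m f (Set.Icc 0 1)) (Set.Icc 0 1) := by
    intro n
    induction n with
    | zero => exact fun m => contDiffOn_zero.mpr (hdiff m).continuousOn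
    | succ n ih =>
      intro m
      rw [Nat.cast_succ, contDiffOn_succ_iff_derivWithin (uniqueDiffOn_Icc zero_lt_one)]
      refine ⟨hdiff m, fun h => absurd h (by exact_mod_cast WithTop.natCast_ne_top n), ?_⟩
      rw [← iteratedDerivWithin_succ]
      exact ih (m + 1)
  have h := key n 0
  rwa [iteratedDerivWithin_zero] at h

end OneSided

/-! ## §3 The p. 308 family on the closed interval `[0,1]` under the L¹ hypothesis -/

section Closed

variable (χ : CutoffProfile) {ι Ω : Type*} [MeasurableSpace Ω]

/-- **Every one-sided iterated derivative of `t ↦ log z_t` at `t = 0` along `[0,1]` is the corresponding cumulant of `−Ṽ`, under `hL1`**: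
`(dᵅ/dtᵅ)|_{t=0,[0,1]} log z_t = (dᵅ/dtᵅ)|₀ cgf_{−W}` for EVERY `α` (probability measure, measurable fields, `c_b ≥ c₀ > 0`, `p > 0`, `0 < e_k < e^{−1}`,
measurable `|W| ≤ K`, `z_t ≠ 0` on `(0,1]`). [cite: BalabanImbrieJaffe1988, (5.14.1) p.308] -/
theorem iteratedDerivWithin_log_restrictedInteraction_zero_of_L1 {p : ℝ} (hp : 0 < p) (P : Measure Ω) [IsProbabilityMeasure P]
    (B : Finset ι) {Φ : ι → Ω → ℝ} (hΦ : ∀ b ∈ B, Measurable (Φ b)) {c : ι → ℝ} {c₀ : ℝ} (hc₀ : 0 < c₀) (hcb : ∀ b ∈ B, c₀ ≤ c b)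
    {W : Ω → ℝ} (hW : Measurable W) {K : ℝ} (hK : ∀ ω, |W ω| ≤ K) {ek : ℝ} (hek : 0 < ek) (hek1 : ek < Real.exp (-1))
    (hz : ∀ t ∈ Set.Ioc (0 : ℝ) 1, (∫ ω, (∏ b ∈ B, cutoff χ (c b * pLog p (t * ek)) (Φ b ω)) * Real.exp (-(t * W ω)) ∂P) ≠ 0)
    (hL1 : ∀ i, 1 ≤ i → Tendsto (fun t => ∫ ω, |iteratedDeriv i (fun s => ∏ b ∈ B, cutoff χ (c b * pLog p (s * ek)) (Φ b ω)) t| ∂P)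
      (𝓝[>] (0 : ℝ)) (𝓝 0)) (α : ℕ) :
    iteratedDerivWithin α (fun t => Real.log
        (∫ ω, (∏ b ∈ B, cutoff χ (c b * pLog p (t * ek)) (Φ b ω)) * Real.exp (-(t * W ω)) ∂P)) (Set.Icc 0 1) 0 =
      iteratedDeriv α (cgf (fun ω => -W ω) P) 0 := by
  have hcpos : ∀ b ∈ B, 0 < c b := fun b hb => hc₀.trans_le (hcb b hb)
  have hcne : ∀ b ∈ B, c b ≠ 0 := fun b hb => (hcpos b hb).ne'
  exact iteratedDerivWithin_Icc_zero_eq_of_tendsto (L := fun β => iteratedDeriv β (cgf (fun ω => -W ω) P) 0)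
    (fun n t ht => BIJ88PerturbativeRemainder308.contDiffAt_log_restrictedInteraction χ p P B hΦ hcne hW hK hek hek1 hz n ht)
    (by rw [iteratedDeriv_zero]; exact BIJ88PertTerms5141.log_integral_restrictedInteraction_at_zero χ hp.ne' P B Φ c W ek)
    (fun β => tendsto_iteratedDeriv_log_restrictedInteraction_cgf_of_L1 χ hp P B hΦ hcpos hW hK hek hL1 β) α

/-- **`t ↦ log z_t` is `Cⁿ` on the CLOSED interval `[0,1]` for every `n`, under `hL1`** — the regularity under which the row owner's Taylor formula
`BIJ88Sect5StatementsPart4.taylor_logz` ((5.14.2) on `[0,1]`) applies verbatim (hypotheses as above). [cite: BalabanImbrieJaffe1988, (5.14.2) p.308] -/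
theorem contDiffOn_Icc_log_restrictedInteraction_of_L1 {p : ℝ} (hp : 0 < p) (P : Measure Ω) [IsProbabilityMeasure P]
    (B : Finset ι) {Φ : ι → Ω → ℝ} (hΦ : ∀ b ∈ B, Measurable (Φ b)) {c : ι → ℝ} {c₀ : ℝ} (hc₀ : 0 < c₀) (hcb : ∀ b ∈ B, c₀ ≤ c b)
    {W : Ω → ℝ} (hW : Measurable W) {K : ℝ} (hK : ∀ ω, |W ω| ≤ K) {ek : ℝ} (hek : 0 < ek) (hek1 : ek < Real.exp (-1))
    (hz : ∀ t ∈ Set.Ioc (0 : ℝ) 1, (∫ ω, (∏ b ∈ B, cutoff χ (c b * pLog p (t * ek)) (Φ b ω)) * Real.exp (-(t * W ω)) ∂P) ≠ 0)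
    (hL1 : ∀ i, 1 ≤ i → Tendsto (fun t => ∫ ω, |iteratedDeriv i (fun s => ∏ b ∈ B, cutoff χ (c b * pLog p (s * ek)) (Φ b ω)) t| ∂P)
      (𝓝[>] (0 : ℝ)) (𝓝 0)) (n : ℕ) :
    ContDiffOn ℝ n (fun t => Real.log
        (∫ ω, (∏ b ∈ B, cutoff χ (c b * pLog p (t * ek)) (Φ b ω)) * Real.exp (-(t * W ω)) ∂P)) (Set.Icc 0 1) := by
  have hcpos : ∀ b ∈ B, 0 < c b := fun b hb => hc₀.trans_le (hcb b hb)
  have hcne : ∀ b ∈ B, c b ≠ 0 := fun b hb => (hcpos b hb).ne'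
  exact contDiffOn_Icc_of_tendsto_iteratedDeriv (L := fun β => iteratedDeriv β (cgf (fun ω => -W ω) P) 0)
    (fun n t ht => BIJ88PerturbativeRemainder308.contDiffAt_log_restrictedInteraction χ p P B hΦ hcne hW hK hek hek1 hz n ht)
    (by rw [iteratedDeriv_zero]; exact BIJ88PertTerms5141.log_integral_restrictedInteraction_at_zero χ hp.ne' P B Φ c W ek)
    (fun β => tendsto_iteratedDeriv_log_restrictedInteraction_cgf_of_L1 χ hp P B hΦ hcpos hW hK hek hL1 β) n

/-- **Print's `𝒫̃_{k+1}` AS TYPED equals the cumulant sum, under `hL1`**: `pertP (log z) n̄ = pertPart n̄ (cgf_{−W})` (the row owner's leaf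
`BIJ88Sect5StatementsPart4.pertP`, derivatives AT `t = 0` within `[0,1]`; hypotheses as above). [cite: BalabanImbrieJaffe1988, (5.14.1) p.308] -/
theorem pertP_restrictedInteraction_of_L1 {p : ℝ} (hp : 0 < p) (P : Measure Ω) [IsProbabilityMeasure P]
    (B : Finset ι) {Φ : ι → Ω → ℝ} (hΦ : ∀ b ∈ B, Measurable (Φ b)) {c : ι → ℝ} {c₀ : ℝ} (hc₀ : 0 < c₀) (hcb : ∀ b ∈ B, c₀ ≤ c b)
    {W : Ω → ℝ} (hW : Measurable W) {K : ℝ} (hK : ∀ ω, |W ω| ≤ K) {ek : ℝ} (hek : 0 < ek) (hek1 : ek < Real.exp (-1))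
    (hz : ∀ t ∈ Set.Ioc (0 : ℝ) 1, (∫ ω, (∏ b ∈ B, cutoff χ (c b * pLog p (t * ek)) (Φ b ω)) * Real.exp (-(t * W ω)) ∂P) ≠ 0)
    (hL1 : ∀ i, 1 ≤ i → Tendsto (fun t => ∫ ω, |iteratedDeriv i (fun s => ∏ b ∈ B, cutoff χ (c b * pLog p (s * ek)) (Φ b ω)) t| ∂P)
      (𝓝[>] (0 : ℝ)) (𝓝 0)) (nbar : ℕ) :
    pertP (fun t => Real.log (∫ ω, (∏ b ∈ B, cutoff χ (c b * pLog p (t * ek)) (Φ b ω)) * Real.exp (-(t * W ω)) ∂P)) nbar =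
      pertPart nbar (cgf (fun ω => -W ω) P) := by
  rw [pertP, BIJ88Perturbative341.pertPart_def, Set.uIcc_of_le zero_le_one]
  refine Finset.sum_congr rfl fun α _ => ?_
  rw [iteratedDerivWithin_log_restrictedInteraction_zero_of_L1 χ hp P B hΦ hc₀ hcb hW hK hek hek1 hz hL1 (α + 1)]
  ring

/-- **The row owner's Taylor formula (5.14.2) `taylor_logz` applied to the family under `hL1`** (`log z_0 = 0`):
`log z₁ = −pertP (log z) n̄ + ∫₀¹ ((1−t)^{n̄}/n̄!)·iteratedDerivWithin (n̄+1) (log z) [0,1] t dt` (hypotheses as above).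
[cite: BalabanImbrieJaffe1988, (5.14.2) p.308] -/
theorem taylor_logz_restrictedInteraction_of_L1 {p : ℝ} (hp : 0 < p) (P : Measure Ω) [IsProbabilityMeasure P]
    (B : Finset ι) {Φ : ι → Ω → ℝ} (hΦ : ∀ b ∈ B, Measurable (Φ b)) {c : ι → ℝ} {c₀ : ℝ} (hc₀ : 0 < c₀) (hcb : ∀ b ∈ B, c₀ ≤ c b)
    {W : Ω → ℝ} (hW : Measurable W) {K : ℝ} (hK : ∀ ω, |W ω| ≤ K) {ek : ℝ} (hek : 0 < ek) (hek1 : ek < Real.exp (-1))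
    (hz : ∀ t ∈ Set.Ioc (0 : ℝ) 1, (∫ ω, (∏ b ∈ B, cutoff χ (c b * pLog p (t * ek)) (Φ b ω)) * Real.exp (-(t * W ω)) ∂P) ≠ 0)
    (hL1 : ∀ i, 1 ≤ i → Tendsto (fun t => ∫ ω, |iteratedDeriv i (fun s => ∏ b ∈ B, cutoff χ (c b * pLog p (s * ek)) (Φ b ω)) t| ∂P)
      (𝓝[>] (0 : ℝ)) (𝓝 0)) (nbar : ℕ) :
    Real.log (∫ ω, (∏ b ∈ B, cutoff χ (c b * pLog p (1 * ek)) (Φ b ω)) * Real.exp (-(1 * W ω)) ∂P) =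
      -pertP (fun t => Real.log (∫ ω, (∏ b ∈ B, cutoff χ (c b * pLog p (t * ek)) (Φ b ω)) * Real.exp (-(t * W ω)) ∂P)) nbar +
        ∫ t in (0 : ℝ)..1, ((1 - t) ^ nbar / nbar.factorial) * iteratedDerivWithin (nbar + 1) (fun t => Real.log
          (∫ ω, (∏ b ∈ B, cutoff χ (c b * pLog p (t * ek)) (Φ b ω)) * Real.exp (-(t * W ω)) ∂P)) (Set.uIcc 0 1) t := by
  have hcd := contDiffOn_Icc_log_restrictedInteraction_of_L1 χ hp P B hΦ hc₀ hcb hW hK hek hek1 hz hL1 (nbar + 1)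
  rw [← Set.uIcc_of_le zero_le_one] at hcd
  have h := BIJ88Sect5StatementsPart4.taylor_logz (nbar := nbar) hcd
  rw [BIJ88PertTerms5141.log_integral_restrictedInteraction_at_zero χ hp.ne' P B Φ c W ek, cgf_zero, zero_sub] at h
  exact h

end Closed

end Literature.MathematicalPhysics.QuantumFieldTheory.BalabanImbrieJaffe1984to88.BIJ88RestrictionsL1Decay308
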